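import Summits.BirchSwinnertonDyer.Rank1Residual.X11b.CastellaErratumVersionOfRecordEndForm
import Literature.NumberTheory.DiophantineGeometry.AbcWave0GranvilleStarkTheorem2Proofs
import HarnessLib

/-!
# X11b at `p = 3`, route R1's DESCENT half (Castella §5 over erratum fields) — SKELETON (cell `b2b-bsdres`, team N8/O2 = `x11b3`, seat p6, sub-target R1@3-DESCENT)

HONEST FRAMING (cell `b2b-bsdres`, run/shared/lean/b2b/bsd-rank1-residual/, verbatim in every
file): the goal of the cell is to DELETE the COMBINATION-SHAPED residual classes of the
Birch–Swinnerton-Dyer formula for ALL analytic-rank `≤ 1` elliptic curves over `ℚ` — "full BSD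
formula for every rank `≤ 1` curve in class `C`" assembled STRICTLY from published theorems — so
that the rank-`≤ 1` remainder becomes exactly the CONSTRUCTION-SHAPED classes, which are TYPED
(missing-input `Prop`s), NOT attempted. This is not "finishing BSD". Team `x11b3` (N8/O2: X11b at
`p = 3` — `3 ∥ N`, `r = 1`, `E[3]` irreducible; STEP L at `3` = anticyclotomic IMC divisibility ∘
BDP-type formula at `3 ∥ N`, + (T2′)); a RESEARCH ROUTE; no claim beyond the stated class; X11 ∧
`r = 1` at `p = 3` stays CONSTRUCTION-SHAPED (REFEREE.md R6.2) / O2 OPEN (RESIDUAL-MAP §I); nothing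
here books anything or changes a label. THEOREMS ONLY (no `def`, no named fact, no `sorry`).

## What this file is

Route R1 of sub-cell `multr1-p1` (`X11b/RouteR1.lean`, `X11b/CastellaErratum*.lean`) re-assembles
Castella, Camb. J. Math. 6 (2018) §5 — "the same argument as in [Cas18, §5]" of the author's erratum
(Thm. A′) — in the kernel: for a rank-one pair on `ChainLocus W p` (`5 ≤ p ∧ Mult W p ∧ Irr W p ∧
X11.AprimeRam2LocusAt W p`) with an odd non-split ramified multiplicative `q`, `BSD(E,p)` follows from
EIGHT published named facts and ONE open input (A|VoR) = Castella's display (5.3) over ERRATUM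
fields (`q ∣ d_K`, every other prime of `N_E` split, `L(E^{d_K},1) ≠ 0`), through the links (B)
Gross–Zagier paraphrase and (C) Tamagawa descent, both PROVED there — but only for `5 ≤ p`: the
population predicate hard-codes `5 ≤ p`, and the proofs of (B) (`gzParaphraseAt_of_datum`: `p ∤ w_K`
from `p ≥ 5`) and (C) (`tamagawaDescentAt_of_isErratumField`: "`c_ℓ ≤ 4 < p` at additive places",
which FAILS at `3`: Kodaira types IV, IV* have `c = 3`) use it.

This file is the SKELETON (team protocol, `cells/x11b3/REFEREE.md` §1) of the `p = 3` version of
that descent: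

* `not_dvd_unitsTorsionOrder_of_isErratumField` — `p ∤ #𝓞_K^×` for every ODD `p` on an erratum
  field at an odd `q` (`d_K ≤ −7`, so `w_K = 2`; tree theorem `torsionOrder_eq_two_of_discr_lt`):
  the `w_K`-proviso of (B) at `p = 3`.
* `cas20Standing_of_isErratumField_odd` — every erratum field at an odd `q` meets [Cas20, §2.5]'s
  standing hypotheses at the tame level `N_E/p` for every ODD multiplicative `p`
  (`IsErratumField.cas20Standing` without `ErratumHypotheses`).
* `bsdp_of_links_odd` — the valuation bookkeeping "links (A)+(B)+(C) + Skinner 2016 Thm. C for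
  `E^D` ⟹ `BSD(E,p)`" for every `p ≥ 3` (`bsdp_of_links` asked `5 ≤ p` but uses only Skinner's
  printed `p ≥ 3`, footnote 1, and `p ≠ 2` for `Ш(E/K)[p^∞] = Ш(E)[p^∞]·Ш(E^D)[p^∞]`).
* **`R1.bsdp_three_of_display_skeleton`** — for `W/ℚ` globally minimal with `IsX11Three W`
  (`3 ∥ N`, `E[3]` irreducible, `ord_{s=1}L(E,s) = 1`) ON the A′ ∧ (ram2)-locus at `3`
  (`X11.AprimeRam2LocusAt W 3`: a non-split multiplicative `q ≠ 3` with `3 ∤ v_q(Δ_min)`, a second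
  multiplicative `ℓ ∉ {3, q}` with `3 ∤ v_ℓ(Δ_min)`, `E(ℚ₃)[3] = 0`), an ODD such `q`, and an erratum
  field `K` for `q`: `BSD(E,3)` from SEVEN published named facts (`hGZ` Gross–Zagier 1986 I.7.3,
  `hGZK` Gross–Zagier–Kolyvagin, `hSk` Skinner 2016 Thm. C — printed for `p ≥ 3`, applied to the
  rank-0 twist `E^D` at the multiplicative prime `3` —, `hmod` modularity, `hCST` Cai–Shu–Tian 2014
  Thm. 1.1, `hMaz` Mazur 1978 Cor. 4.1 — `3 ∥ N ⇒ 3 ∤ c_Manin` —, `hNS` Néron scaling), ONE OPEN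
  binder `hA` = (A|VoR)@3 and TWO NAMED STUBS `stub_gzParaphraseAt_three` ((B)@3) and
  `stub_tamagawaDescentAt_three` ((C)@3) — the two links whose tree proofs use `5 ≤ p`. Both stubs
  are PROVABLE from tree theorems (dischargers filed next by this seat: `Three/RouteR1Tamagawa.lean`
  — `c_ℓ(E^D) ∈ {1,2,4}` at `ℓ ∣ d_K` by Kodaira `I₀*`/`Iₙ*`, `Additive.tamagawaNumberAt_twist_of_semistable_mem`;
  `Three/RouteR1GrossZagier.lean` — `gzParaphraseAt_of_datum` with `w_K = 2`); the END FORM without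
  stubs is `Three/RouteR1EndForm.lean`.
* `R1.forall_bsdp_three_of_display_skeleton` — the class-level form, the field supplied by
  Friedberg–Hoffstein 1995 Thm. B (`hFH`, `erratumField_supply`).

## The ONE open binder, and why it is OPEN at `p = 3` (hypothesis police, REFEREE.md §2)

`hA` = (A|VoR)@3: Castella's display (5.3) `ord_3 #Ш(E/K)[3^∞] = 2·ord_3[E(K):ℤP] − ord_3 ∏_w c_w(E/K)`
(`Display53At W 3 K P`, multr1-p1's per-pair SHAPE, nothing asserted) at the Heegner point `P` of a
parametrisation datum of level `N_E` with `3 ∤ c`, over an erratum field `K` for `q` meeting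
[Cas20, §2.5] at the tame level `N_E/3` (`Cas20Standing K 3 (N_E/3)` — a THEOREM on such fields,
`cas20Standing_of_isErratumField_odd`; displayed because it is where the `p ≥ 5` input is printed).
NOT a cited fact; NO source and NO announcement at `p = 3`. Its printed derivation at `p ≥ 5` —
erratum Thm. 1.1 ⇐ [FW21, Thm. 4.41] (H6: `p ≥ 5`, PREPRINT) + Hida theory (a), (b) + (c) =
[Cas20, Thm. 2.11] (H2: §1 "fix a prime `p ∤ 6N`") + the explicit reciprocity law [Cas20, Thm. 5.3]
(H2) + Cas18 Thm. 3.2 (`p ∥ N` Waldspurger formula ⇐ Castella JIMJ 17, H3: "`p ≥ 5`", `E_{p−1}`) +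
Cas18 Thm. 2.3 (control, JSW17 Thm. 3.3.1, printed for `p ≥ 3`) — rests on three rows that are ⊥ at
`(E, 3)`, `3 ∥ N` (REFEREE.md §2 H2, H3, H6). The transport that would replace them is the team's
object of study (PLAN.md T1/T6/T7); this file only localises the obstruction: GIVEN the display at
`3`, nothing else in Castella's §5 descent needs `p ≥ 5`.

## Relation to the kernel of record at `p = 3`

multr1-p2's `P2.bsdp_three_of_onTree` (`X11b/BDPRouteOpenInputOdd.lean`) types STEP L at `3` in
INEQUALITY form at CLASSICAL Heegner fields (every prime of `N_E` split) and needs, besides the open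
input, the Euler-system half (T2′)@3 OFF the unconditional atom `(ram) ∧ 3 ∤ ∏c`. Route R1 types it
in EQUALITY form at ERRATUM fields and needs NO (T2′): on R1's population ∩ (T2′)@3 the upper half
comes with the display. The two-routes statement at `3` is in `Three/RouteR1EndForm.lean`.

References: [Castella2018] §5 (arXiv:1704.06608 p. 12); [Castella2018Erratum] Thm. 1.1, Thm. A′
(p. 1), proof of Thm. 1.1 (p. 4); [Castella2020JIMJ] §1 (author PDF p. 2: "`p ∤ 6N`"), §2.5 (p. 8),
Thm. 2.11 (p. 12); [Skinner2016PacificMC] Thm. C and footnote 1 (`p ≥ 3`); [CaiShuTian2014]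
Thm. 1.1; [GrossZagier1986] Thm. I.7.3; [Mazur1978] Cor. 4.1; [FriedbergHoffstein1995] Thm. B;
[Cox2013] §7.A (`w_K = 2` for `d_K < −4`). Cell record: HOME/cells/x11b3/OWNERS.md row R1@3-DESCENT;
HOME/b2b-bsdres-multr1-p1/REPORT.md (route R1).
-/

noncomputable section

open scoped Classical

open WeierstrassCurve NumberField Literature.NumberTheory.EllipticCurves
  Literature.NumberTheory.EllipticCurves.ModularForms
  Literature.NumberTheory.EllipticCurves.Rank1Residual
  Literature.NumberTheory.EllipticCurves.Rank1Residual.Typed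
  Literature.NumberTheory.EllipticCurves.Wuthrich2014

namespace Summit.BirchSwinnertonDyer.Rank1Residual.X11b.Three

/-! ### The three `p`-dependent lemmas of the chain, at every odd prime -/

section OddPrime

variable (W : WeierstrassCurve ℚ) [W.IsElliptic] [W.IsGloballyMinimal] (p : ℕ) [Fact p.Prime]

omit [W.IsElliptic] [W.IsGloballyMinimal] in
/-- **`p ∤ #𝓞_K^×` for every odd `p` on an erratum field at an odd `q`.** An erratum field for an
odd `q` has `d_K ≡ 1 (mod 8)`, `d_K < 0`, hence `d_K ≤ −7` (`IsErratumField.discr_le_neg_seven`), so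
`w_K = #𝓞_K^× = 2` (Cox §7.A; tree theorem `torsionOrder_eq_two_of_discr_lt`) and no odd prime
divides it. This replaces `not_dvd_torsionOrder_of_finrank_le_two` (`p ≥ 5`) of the `p ≥ 5` chain
at `p = 3`, where `w_K = 6` for `K = ℚ(√−3)` would matter — but `ℚ(√−3)` is never an erratum field
at an odd `q` (`q ∣ d_K = −3` forces `q = 3 = p`, excluded; directly: `d_K ≤ −7`).
[cite: Cox2013, §7.A] -/
theorem not_dvd_unitsTorsionOrder_of_isErratumField {K : Type} [Field K] [NumberField K] {q : ℕ}
    (hK : IsErratumField W K q) (hq2 : q ≠ 2) (hp2 : p ≠ 2) :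
    ¬ p ∣ Units.torsionOrder K := by
  have hpP : p.Prime := Fact.out
  have h7 := hK.discr_le_neg_seven hq2
  rw [Literature.NumberTheory.DiophantineGeometry.torsionOrder_eq_two_of_discr_lt hK.1.1 (by omega)]
  intro h
  have h2 := Nat.le_of_dvd two_pos h
  have := hpP.two_le
  omega

omit [W.IsGloballyMinimal] in
/-- **Every erratum field at an odd `q` meets ALL standing hypotheses of [Cas20, §2.5] at the tame
level `N_E/p`, for every ODD multiplicative prime `p ≠ q`** — `IsErratumField.cas20Standing` with its
`ErratumHypotheses W p` (which carries `5 ≤ p`) weakened to `p ≠ 2 ∧ Mult W p`, the only clauses its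
proof uses: `K` imaginary quadratic, `d_K` odd and `< −3`, `2 < p`, `p` split in `K` (a prime of
`N_E` other than `q`), `0 < N_E/p`, `p ∤ N_E/p` (`p ∥ N_E`), (heeg) at `N_E/p`. Bookkeeping; the
hypotheses are displayed because [Cas20, Thm. 2.11] is printed under them (and under §1's
"`p ∤ 6N`", which FAILS at `p = 3` — see the module docstring; nothing about Thm. 2.11 is used here).
[cite: Castella2020JIMJ, §2.5 (author PDF p. 8), standing hypotheses and (heeg)] -/
theorem cas20Standing_of_isErratumField_odd (hp2 : p ≠ 2) (hmult : Mult W p) {q : ℕ} [Fact q.Prime]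
    (hqp : q ≠ p) (hq2 : q ≠ 2) (hmq : Mult W q) {K : Type} [Field K] [NumberField K]
    (hK : IsErratumField W K q) : Cas20Standing K p (W.conductorNorm ℤ / p) := by
  have hpP : p.Prime := Fact.out
  have hp3 : 2 < p := by have := hpP.two_le; omega
  exact ⟨hK.1, hK.odd_discr hq2, hK.discr_lt_neg_three hq2, hp3,
    hK.splitsIn_of_mult hmult (Ne.symm hqp), tameLevel_pos hmult, not_dvd_tameLevel hmult,
    hK.heeg_tameLevel hmult hmq⟩

omit [W.IsGloballyMinimal] in
/-- **Castella §5 in the erratum's setting, per pair, at every `p ≥ 3`: links ⟹ `BSD(E,p)`.**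
`bsdp_of_links` of `CastellaErratumChain.lean` VERBATIM with its hypothesis `5 ≤ p` weakened to
`3 ≤ p` — its proof uses only Skinner, Pacific J. Math. 283 (2016) Thm. C for the twist `Wd` (PUB
named fact `hSk`, printed for "a prime `p ≥ 3`", footnote 1; hypotheses: `Wd` multiplicative at `p`,
`E^D[p]` irreducible, a multiplicative `ℓ ≠ p` of `Wd` with `p ∤ v_ℓ(Δ_min(Wd))`, `L(E^D,1) ≠ 0`,
`Ш(E^D)` finite by GZK) and the odd-`p` valuation bookkeeping `padicVal_printShape_of_links`
(`p ≠ 2`: `#Ш(E/K)[p^∞] = #Ш(E)[p^∞]·#Ш(E^D)[p^∞]`). Links: (A) `Display53At`, (B) `GZParaphraseAt`,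
(C) `TamagawaDescentAt`. [cite: Castella2018, §5 (arXiv:1704.06608 p. 12), last step]
[cite: Skinner2016PacificMC, Thm. C (§1) and footnote 1] -/
theorem bsdp_of_links_odd
    (hGZ : GrossZagier1986_thm_I_7_3) (hGZK : rank_eq_analyticRank_of_analyticRank_le_one)
    (hSk : Skinner2016.thmC_padicValRat_bsd_rank_zero)
    (hp3 : 3 ≤ p) (hirr : Irr W p) (hr : W.analyticRank = 1)
    (K : Type) [Field K] [NumberField K] (hK : IsImaginaryQuadratic K)
    (Wd : WeierstrassCurve ℚ) [Wd.IsElliptic] [Wd.IsGloballyMinimal]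
    (hWd : ∃ C : VariableChange ℚ, C • W.quadraticTwist (NumberField.discr K : ℚ) = Wd)
    (hLd : Wd.entireLFunction 1 ≠ 0) (hmultd : Mult Wd p) (hirrd : Irr Wd p)
    (hramd : ∃ (ℓ : ℕ) (_ : Fact ℓ.Prime), ℓ ≠ p ∧ Mult Wd ℓ ∧
      ¬ p ∣ padicValInt ℓ Wd.minimalDiscriminantInt)
    (P : (W.baseChange K).toAffine.Point)
    (hA : Display53At W p K P) (hB : GZParaphraseAt W p K P Wd) (hC : TamagawaDescentAt W p K Wd) :
    BSDp W p := by
  have hrd : Wd.analyticRank = 0 :=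
    Literature.NumberTheory.EllipticCurves.analyticRank_eq_zero_of_entireLFunction_one_ne_zero Wd hLd
  obtain ⟨-, hfind⟩ := hGZK Wd (by omega)
  have hD : PPartRankZero Wd p := hSk Wd p hp3 (Or.inr hmultd) hirrd hramd hLd hfind
  exact bsdp_of_padicVal_printShape W p hGZK (le_of_eq hr) hirr
    (padicVal_printShape_of_links W p hGZ hGZK (by omega) hr K hK Wd hWd hirrd hLd hD P hA hB hC)

end OddPrime

/-! ### The skeleton at `p = 3`: published facts + ONE open binder + two named stubs -/

section Three

/-- **Route R1's descent at `p = 3`, SKELETON (per pair, with a GIVEN erratum field).** For `W/ℚ`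
globally minimal with `IsX11Three W` (`3 ∥ N_E`, `E[3]` irreducible, `ord_{s=1} L(E,s) = 1`) on the
A′ ∧ (ram2)-locus at `3` (`X11.AprimeRam2LocusAt W 3`), an ODD prime `q ≠ 3` of non-split
multiplicative reduction with `3 ∤ v_q(Δ_min)`, and an erratum field `K` for `q`: `BSD(E,3)`
(Miller's `BSDp W 3`), from
* SEVEN PUBLISHED named facts: `hGZ` (Gross–Zagier 1986 Thm. I.7.3), `hGZK` (Gross–Zagier–Kolyvagin
  over `ℚ`), `hSk` (Skinner 2016 Thm. C, `p ≥ 3`, for `E^D`), `hmod` (modularity), `hCST`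
  (Cai–Shu–Tian 2014 Thm. 1.1), `hMaz` (Mazur 1978 Cor. 4.1: `p ∣ c ⇒ p² ∣ 4N`, so `3 ∤ c` at
  `3 ∥ N`), `hNS` (Néron mapping property);
* ONE OPEN binder `hA` = (A|VoR)@3 — Castella's display (5.3) at `p = 3` at every Manin-good
  Heegner datum over erratum fields meeting [Cas20, §2.5] at `N_E/3` (module docstring: NOT a cited
  fact; no source, no announcement at `3`; its `p ≥ 5` derivation rests on rows H2/H3/H6 of
  `cells/x11b3/REFEREE.md` §2, all ⊥ at `(E,3)`);
* TWO NAMED STUBS, both provable from tree theorems and discharged in the companion files: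
  `stub_gzParaphraseAt_three` = link (B) at `3` (`GZParaphraseAt W 3 K P Wd`: needs `3 ∤ w_K`,
  `not_dvd_unitsTorsionOrder_of_isErratumField`) and `stub_tamagawaDescentAt_three` = link (C) at `3`
  (`TamagawaDescentAt W 3 K Wd`: needs `3 ∤ c_ℓ(E^D)` at `ℓ ∣ d_K`, Kodaira `I₀*`/`Iₙ*`).
Proof = the body of multr1-p1's `bsdp_of_display_versionOfRecord` with `5 ≤ p` replaced by `p = 3`:
second ramified prime from the locus, `Cas20Standing` (`cas20Standing_of_isErratumField_odd`), a
Manin-good datum (`exists_modularParametrizationData_not_dvd`, `p ≠ 2`, `9 ∤ N_E`), its Heegner point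
of infinite order (`heegnerDatumSupply_of_caiShuTian`), a globally minimal model `Wd` of `E^{(d_K)}`
with the twist transports at the split primes `3`, `ℓ` (`twistTransportAt_of_twist`), then
`bsdp_of_links_odd`. CONDITIONAL on `hA` (OPEN) and the two stubs; deletes nothing; X11 ∧ `r = 1` at
`3` stays CONSTRUCTION-SHAPED. [cite: Castella2018, §5 (arXiv:1704.06608 p. 12)]
[cite: Castella2018Erratum, Thm. 1.1 and Thm. A′ (p. 1) with "p > 3" read as "p = 3" (shape only; nothing asserted)] -/
theorem R1.bsdp_three_of_display_skeleton
    (hGZ : GrossZagier1986_thm_I_7_3) (hGZK : rank_eq_analyticRank_of_analyticRank_le_one)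
    (hSk : Skinner2016.thmC_padicValRat_bsd_rank_zero) (hmod : exists_isNewformOf)
    (hCST : CaiShuTian2014.thm11_trivialChar)
    (hMaz : mazur_not_dvd_maninConstant_of_odd) (hNS : integral_neronScaling_of_isGloballyMinimal)
    -- OPEN: (A|VoR)@3 — the display (5.3) at `p = 3` over erratum fields meeting [Cas20, §2.5]
    (hA : ∀ (W : WeierstrassCurve ℚ) [W.IsElliptic] [W.IsGloballyMinimal] [NeZero (W.conductorNorm ℤ)]
        (q : ℕ) [Fact q.Prime] (K : Type) [Field K] [NumberField K]
        (Dt : ModularParametrizationData W (W.conductorNorm ℤ))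
        (H : HeegnerDatum (W.conductorNorm ℤ) (NumberField.discr K)) (ι : K →+* ℂ)
        (P : (W.baseChange K).toAffine.Point),
        IsX11Three W → X11.AprimeLocusAt W 3 → q ≠ 3 → Mult W q →
        ¬ W.HasSplitMultiplicativeReductionAtPrime q → ¬ 3 ∣ padicValInt q W.minimalDiscriminantInt →
        IsErratumField W K q → Cas20Standing K 3 (W.conductorNorm ℤ / 3) →
        WeierstrassCurve.Affine.Point.map ι.toRatAlgHom P = heegnerPointComplex Dt H →
        ¬ (3 : ℤ) ∣ Dt.c → ¬ IsOfFinAddOrder P → Display53At W 3 K P)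
    -- STUB (B)@3: the Gross–Zagier paraphrase at `p = 3` (discharged in `Three/RouteR1GrossZagier.lean`)
    (stub_gzParaphraseAt_three : ∀ (W : WeierstrassCurve ℚ) [W.IsElliptic] [W.IsGloballyMinimal]
        [NeZero (W.conductorNorm ℤ)] (q : ℕ) [Fact q.Prime] (K : Type) [Field K] [NumberField K]
        (Dt : ModularParametrizationData W (W.conductorNorm ℤ))
        (H : HeegnerDatum (W.conductorNorm ℤ) (NumberField.discr K)) (ι : K →+* ℂ)
        (P : (W.baseChange K).toAffine.Point) (Wd : WeierstrassCurve ℚ) [Wd.IsElliptic]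
        [Wd.IsGloballyMinimal] (Cd : VariableChange ℚ),
        W.analyticRank = 1 → Irr W 3 → q ≠ 2 → Mult W q →
        ¬ W.HasSplitMultiplicativeReductionAtPrime q → IsErratumField W K q → SplitsIn K 3 →
        WeierstrassCurve.Affine.Point.map ι.toRatAlgHom P = heegnerPointComplex Dt H →
        ¬ (3 : ℤ) ∣ Dt.c → ¬ IsOfFinAddOrder P →
        Cd • W.quadraticTwist (NumberField.discr K : ℚ) = Wd → GZParaphraseAt W 3 K P Wd)
    -- STUB (C)@3: the Tamagawa descent at `p = 3` (discharged in `Three/RouteR1Tamagawa.lean`)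
    (stub_tamagawaDescentAt_three : ∀ (W : WeierstrassCurve ℚ) [W.IsElliptic] [W.IsGloballyMinimal]
        (q : ℕ) [Fact q.Prime] (K : Type) [Field K] [NumberField K] (Wd : WeierstrassCurve ℚ)
        [Wd.IsElliptic], q ≠ 2 → Mult W q → ¬ 3 ∣ padicValInt q W.minimalDiscriminantInt →
        IsErratumField W K q →
        (∃ C : VariableChange ℚ, C • W.quadraticTwist (NumberField.discr K : ℚ) = Wd) →
        TamagawaDescentAt W 3 K Wd)
    (W : WeierstrassCurve ℚ) [W.IsElliptic] [W.IsGloballyMinimal]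
    (hX : IsX11Three W) (hloc : X11.AprimeRam2LocusAt W 3)
    (q : ℕ) [Fact q.Prime] (hq2 : q ≠ 2) (hq3 : q ≠ 3) (hmq : Mult W q)
    (hnsq : ¬ W.HasSplitMultiplicativeReductionAtPrime q)
    (hvq : ¬ 3 ∣ padicValInt q W.minimalDiscriminantInt)
    (K : Type) [Field K] [NumberField K] (hKf : IsErratumField W K q) : BSDp W 3 := by
  haveI : NeZero (W.conductorNorm ℤ) := ⟨(W.conductorNorm_pos_holds).ne'⟩
  have hmodE : hasEntireLFunction_rat := hasEntireLFunction_rat_of_exists_isNewformOf hmod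
  have hmult : Mult W 3 := hX.mult
  have hirr : Irr W 3 := hX.irr
  have hr : W.analyticRank = 1 := hX.rank
  have hloc' : X11.AprimeLocusAt W 3 := X11.aprimeLocusAt_of_aprimeRam2LocusAt hloc
  -- a second ramified multiplicative prime `ℓ ∉ {3, q}` from the (ram2) locus
  obtain ⟨ℓ, hℓF, hℓp, hℓq, hmℓ, hvℓ⟩ : ∃ (ℓ : ℕ) (_ : Fact ℓ.Prime), ℓ ≠ 3 ∧ ℓ ≠ q ∧ Mult W ℓ ∧
      ¬ 3 ∣ padicValInt ℓ W.minimalDiscriminantInt := by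
    obtain ⟨⟨q₀, hq₀F, ℓ₀, hℓ₀F, hq₀p, hℓ₀p, hℓ₀q₀, hmq₀, -, hvq₀, hmℓ₀, hvℓ₀⟩, -⟩ := hloc
    by_cases h : q₀ = q
    · subst h
      exact ⟨ℓ₀, hℓ₀F, hℓ₀p, hℓ₀q₀, hmℓ₀, hvℓ₀⟩
    · exact ⟨q₀, hq₀F, hq₀p, h, hmq₀, hvq₀⟩
  -- the version of record's standing hypotheses hold on `K` at the tame level `N_E/3`
  have hVoR : Cas20Standing K 3 (W.conductorNorm ℤ / 3) :=
    cas20Standing_of_isErratumField_odd W 3 (by decide) hmult hq3 hq2 hmq hKf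
  -- a datum with Manin constant prime to `3` (Mazur: `3 ∣ c ⇒ 9 ∣ 4N`, but `3 ∥ N`), its Heegner point
  obtain ⟨Dt, hc⟩ := exists_modularParametrizationData_not_dvd hmod hMaz hNS W rfl Nat.prime_three
    (by decide) (not_sq_dvd_conductorNorm_of_mult W 3 hmult) hirr
  obtain ⟨H, ι, P, hP, hnt⟩ :=
    heegnerDatumSupply_of_caiShuTian W hmodE
      (CaiShuTian2014.exists_isHeegnerPoint_of_heegnerCondition_of_modularity
        (nonempty_modularParametrizationData_iff_exists_isNewformOf_unconditional.mpr hmod))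
      CaiShuTian2014.exists_map_eq_heegnerPointComplex_of_heegnerCondition_holds hCST hr hmq hnsq
      hKf Dt
  -- a globally minimal model of the twist and the transports at the split primes `3`, `ℓ`
  have hd0 : (NumberField.discr K : ℚ) ≠ 0 := by exact_mod_cast NumberField.discr_ne_zero K
  haveI := W.isElliptic_quadraticTwist hd0
  obtain ⟨C, hCmin⟩ := hasGlobalMinimalModel_rat_holds (W.quadraticTwist (NumberField.discr K : ℚ))
  set Wd := C • W.quadraticTwist (NumberField.discr K : ℚ) with hWd_def
  haveI : Wd.IsGloballyMinimal := hCmin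
  have hWd : ∃ C' : VariableChange ℚ, C' • W.quadraticTwist (NumberField.discr K : ℚ) = Wd :=
    ⟨C, rfl⟩
  obtain ⟨htm, hti, htr⟩ := twistTransportAt_of_twist W 3 hKf.1 Wd hWd
  have hsp : SplitsIn K 3 := hKf.splitsIn_of_mult hmult (Ne.symm hq3)
  have hsℓ : SplitsIn K ℓ := hKf.splitsIn_of_mult hmℓ hℓq
  have hmultd : Mult Wd 3 := htm hsp hmult
  have hirrd : Irr Wd 3 := hti hirr
  obtain ⟨hmℓd, hvℓd⟩ := htr ℓ hℓp hsℓ hmℓ hvℓ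
  have hLd : Wd.entireLFunction 1 ≠ 0 := by
    rw [hWd_def, WeierstrassCurve.entireLFunction_smul]
    exact hKf.2.2.2.2
  -- links (A|VoR)@3 [OPEN input], (B)@3, (C)@3 [stubs] and the odd-`p` bookkeeping
  exact bsdp_of_links_odd W 3 hGZ hGZK hSk le_rfl hirr hr K hKf.1 Wd hWd hLd hmultd hirrd
    ⟨ℓ, hℓF, hℓp, hmℓd, hvℓd⟩ P
    (hA W q K Dt H ι P hX hloc' hq3 hmq hnsq hvq hKf hVoR hP hc hnt)
    (stub_gzParaphraseAt_three W q K Dt H ι P Wd C hr hirr hq2 hmq hnsq hKf hsp hP hc hnt rfl)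
    (stub_tamagawaDescentAt_three W q K Wd hq2 hmq hvq hKf hWd)

/-- **Route R1's descent at `p = 3`, SKELETON, class level — the field supplied.** For EVERY
globally minimal elliptic `W/ℚ` with `IsX11Three W` on the A′ ∧ (ram2)-locus at `3` having an ODD
non-split multiplicative `q ≠ 3` with `3 ∤ v_q(Δ_min)`: `BSD(E,3)`, from the seven published facts
of `R1.bsdp_three_of_display_skeleton`, Friedberg–Hoffstein 1995 Thm. B in the special case "the
erratum field exists" (`hFH`, PUB; `erratumField_supply`: the sign is `−1` at analytic rank one),
the OPEN binder (A|VoR)@3 and the two named stubs (B)@3, (C)@3. The sub-population is named exactly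
(`IsX11Three` + the A′ ∧ (ram2) locus at `3` + an odd `q`); NOT a statement about the class
`IsX11Three` / X11b@3 as a whole (census of the sub-population: seat dir
HOME/b2b-bsdres-x11b3-p6/). CONDITIONAL; deletes nothing; X11 ∧ `r = 1` at `3` stays
CONSTRUCTION-SHAPED. [cite: Castella2018, §5 (arXiv:1704.06608 p. 12)]
[cite: FriedbergHoffstein1995, Thm. B (special case)]
[cite: Castella2018Erratum, Thm. A′ (p. 1) with "p > 3" read as "p = 3" (shape only; nothing asserted)] -/
theorem R1.forall_bsdp_three_of_display_skeleton
    (hGZ : GrossZagier1986_thm_I_7_3) (hGZK : rank_eq_analyticRank_of_analyticRank_le_one)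
    (hSk : Skinner2016.thmC_padicValRat_bsd_rank_zero) (hmod : exists_isNewformOf)
    (hCST : CaiShuTian2014.thm11_trivialChar)
    (hFH : friedbergHoffstein_exists_twist_ne_zero_ramifiedAt)
    (hMaz : mazur_not_dvd_maninConstant_of_odd) (hNS : integral_neronScaling_of_isGloballyMinimal)
    (hA : ∀ (W : WeierstrassCurve ℚ) [W.IsElliptic] [W.IsGloballyMinimal] [NeZero (W.conductorNorm ℤ)]
        (q : ℕ) [Fact q.Prime] (K : Type) [Field K] [NumberField K]
        (Dt : ModularParametrizationData W (W.conductorNorm ℤ))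
        (H : HeegnerDatum (W.conductorNorm ℤ) (NumberField.discr K)) (ι : K →+* ℂ)
        (P : (W.baseChange K).toAffine.Point),
        IsX11Three W → X11.AprimeLocusAt W 3 → q ≠ 3 → Mult W q →
        ¬ W.HasSplitMultiplicativeReductionAtPrime q → ¬ 3 ∣ padicValInt q W.minimalDiscriminantInt →
        IsErratumField W K q → Cas20Standing K 3 (W.conductorNorm ℤ / 3) →
        WeierstrassCurve.Affine.Point.map ι.toRatAlgHom P = heegnerPointComplex Dt H →
        ¬ (3 : ℤ) ∣ Dt.c → ¬ IsOfFinAddOrder P → Display53At W 3 K P)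
    (stub_gzParaphraseAt_three : ∀ (W : WeierstrassCurve ℚ) [W.IsElliptic] [W.IsGloballyMinimal]
        [NeZero (W.conductorNorm ℤ)] (q : ℕ) [Fact q.Prime] (K : Type) [Field K] [NumberField K]
        (Dt : ModularParametrizationData W (W.conductorNorm ℤ))
        (H : HeegnerDatum (W.conductorNorm ℤ) (NumberField.discr K)) (ι : K →+* ℂ)
        (P : (W.baseChange K).toAffine.Point) (Wd : WeierstrassCurve ℚ) [Wd.IsElliptic]
        [Wd.IsGloballyMinimal] (Cd : VariableChange ℚ),
        W.analyticRank = 1 → Irr W 3 → q ≠ 2 → Mult W q →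
        ¬ W.HasSplitMultiplicativeReductionAtPrime q → IsErratumField W K q → SplitsIn K 3 →
        WeierstrassCurve.Affine.Point.map ι.toRatAlgHom P = heegnerPointComplex Dt H →
        ¬ (3 : ℤ) ∣ Dt.c → ¬ IsOfFinAddOrder P →
        Cd • W.quadraticTwist (NumberField.discr K : ℚ) = Wd → GZParaphraseAt W 3 K P Wd)
    (stub_tamagawaDescentAt_three : ∀ (W : WeierstrassCurve ℚ) [W.IsElliptic] [W.IsGloballyMinimal]
        (q : ℕ) [Fact q.Prime] (K : Type) [Field K] [NumberField K] (Wd : WeierstrassCurve ℚ)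
        [Wd.IsElliptic], q ≠ 2 → Mult W q → ¬ 3 ∣ padicValInt q W.minimalDiscriminantInt →
        IsErratumField W K q →
        (∃ C : VariableChange ℚ, C • W.quadraticTwist (NumberField.discr K : ℚ) = Wd) →
        TamagawaDescentAt W 3 K Wd) :
    ∀ (W : WeierstrassCurve ℚ) [W.IsElliptic] [W.IsGloballyMinimal],
      IsX11Three W → X11.AprimeRam2LocusAt W 3 →
      (∃ (q : ℕ) (_ : Fact q.Prime), q ≠ 2 ∧ q ≠ 3 ∧ Mult W q ∧
        ¬ W.HasSplitMultiplicativeReductionAtPrime q ∧ ¬ 3 ∣ padicValInt q W.minimalDiscriminantInt) →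
      BSDp W 3 := by
  intro W _ _ hX hloc ⟨q, hqF, hq2, hq3, hmq, hnsq, hvq⟩
  obtain ⟨K, _, _, hKf⟩ := erratumField_supply hmod hFH W 3 q hX.rank hmq hnsq
  exact R1.bsdp_three_of_display_skeleton hGZ hGZK hSk hmod hCST hMaz hNS hA stub_gzParaphraseAt_three
    stub_tamagawaDescentAt_three W hX hloc q hq2 hq3 hmq hnsq hvq K hKf

end Three

end Summit.BirchSwinnertonDyer.Rank1Residual.X11b.Three

end
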